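import Summits.HubbardSuperconductivity.HubbardSuperconductivity.Theorems.AnisotropyChordTransferFibre3RowCXSWindow
import Summits.HubbardSuperconductivity.HubbardSuperconductivity.Theorems.AnisotropyChordTransferFibre3ClosedExpansions

/-!
# Route `AnisotropyChord` / H0 rotor rung, row C (KT-2b): the L-UNIFORM BRACKET of `XSn` (window + special momenta + tail)

`XSn = Σ_k s(k)` (`…RowCXParseval`, `…RowCXSPointwise`).  Split the torus into the window image
`W = toTor(idxX K)` (`idxX K = {p ∈ zWindow K : p − x̂ ∈ zWindow K}`), the two special momenta `{0, x̂}` (`s(0) = e·G(−x̂)²`,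
`s(x̂) = e·G(x̂)²`) and the rest `R`.  On `W` use ★ `sN_window_le`; on `R` use ★ `sN_tail_le` and control the tail sums by the
TOTALS minus window LOWER sums: `Σ_R G₋² = θ⁴S₂ − Σ_W G₋² − G(−x̂)²`, `Σ_R G·G₋ = θ⁴T10 − Σ_W G·G₋` (`S2n_eq`, `ClosedExp.T10n_eq`,
reindexing), so that p2's cell brackets `x₄ = θ⁴S₂ ≤ x4hi`, `x₇ = θ⁴T10 ≤ x7hi` close the estimate with NO Jordan constant:
★ `XSn_le_xsBoundR`:  for `4K ≤ L`, `1 ≤ K`, `θ² ≤ T ≤ 1`, `0 ≤ ν₁ ≤ ν ≤ ν₂ < 4/π²`, `T/12 + ν₂ < 1`, positive window denominators,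
  `XSn L (νθ²) ≤ xsBoundR T ν₁ ν₂ K x4hi x7hi := 2·Ghi(1,0)² + Σ_{idxX} sHiR + (4c² + 2)(x4hi − Glo(−1,0)² − Σ_{idxX} Glo(p−x̂)²)
  + 4c²(x7hi − Σ_{idxX} Glo(p)Glo(p−x̂))`, `c = cT T ν₂ = 1 + ν₂/(1 − T/12 − ν₂)`.
Numerically (python mirror, `K = 32`, `T = θ₀² = (2π/128)²`): `XSn ≤ XSn·(1.04–1.05)` on p2's ν-cells.  The computable `ℚ`
evaluation of `xsBoundR` and the per-cell certificate are `…RowCXSCells`.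
Prover seat `hubbard-h0-rotor-p1` g28 (route lead); helper for piece A = stmt-HubbardSuperconductivity-23918 of rung 19089
(`--supports`, helper class).  WHAT THIS IS NOT: nothing here proves superconductivity in the Hubbard model; one L-uniform
bracket for one input of ONE row of ONE conditional reduction; the rotor TARGET as originally worded stays FALSE (g15 verdict).
Tree imports only; no sorry, no new axioms.
-/

set_option linter.dupNamespace false
set_option autoImplicit false

noncomputable section

open scoped BigOperators
open Complex

namespace Summit.HubbardSuperconductivity.HubbardSuperconductivity.Theorems.AnisotropyChord.Transfer.Fibre3

namespace RowC

open B1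

variable (L : ℕ) [NeZero L]

/-! ## The index set and the bound -/

/-- the window index set of the `XSn` bracket: `p` and `p − x̂` both in the punctured window. -/
def idxX (K : ℕ) : Finset (ℤ × ℤ) := (box K).filter (fun p => p ∈ zWindow K ∧ shx p ∈ zWindow K)

/-- the L-uniform tail constant `c_T = 1 + ν₂/(1 − T/12 − ν₂)` (`≥ cTail ν θ` for `θ² ≤ T`, `ν ≤ ν₂`). -/
def cT (T ν₂ : ℝ) : ℝ := 1 + ν₂ * (1 / (1 - T / 12 - ν₂))

/-- ★ the L-uniform upper bound of `XSn` on a cell, given upper brackets `x4hi ≥ θ⁴S₂`, `x7hi ≥ θ⁴T10`. -/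
def xsBoundR (T ν₁ ν₂ : ℝ) (K : ℕ) (x4hi x7hi : ℝ) : ℝ :=
  2 * GhiR T ν₂ ((1 : ℤ), (0 : ℤ)) ^ 2 + ∑ p ∈ idxX K, sHiR T ν₁ ν₂ p
    + (4 * cT T ν₂ ^ 2 + 2) * (x4hi - GloR ν₁ ((-1 : ℤ), (0 : ℤ)) ^ 2 - ∑ p ∈ idxX K, GloR ν₁ (shx p) ^ 2)
    + 4 * cT T ν₂ ^ 2 * (x7hi - ∑ p ∈ idxX K, GloR ν₁ p * GloR ν₁ (shx p))

/-! ## The totals -/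

/-- `Σ_k G₋(k)² = θ⁴·S₂`. [folklore] -/
theorem sum_Gm_sq (ν : ℝ) :
    ∑ k : Tor L, Xf L ν ((-1 : ℤ), (0 : ℤ)) k ^ 2
      = ((2 * Real.pi / L) ^ 2) ^ 2 * S2n L (ν * (2 * Real.pi / L) ^ 2) := by
  rw [S2n_eq, Finset.mul_sum]
  rw [← Equiv.sum_comp (Equiv.subRight (K1 L)) (fun k => ((2 * Real.pi / L) ^ 2) ^ 2 * gres L (ν * (2 * Real.pi / L) ^ 2) k ^ 2)]
  refine Finset.sum_congr rfl fun k _ => ?_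
  rw [Xf_negx_eq]
  simp only [Equiv.subRight_apply]
  ring

/-- `Σ_k G(k)G₋(k) = θ⁴·T10`. [folklore] -/
theorem sum_G_Gm (ν : ℝ) :
    ∑ k : Tor L, Xf L ν ((0 : ℤ), (0 : ℤ)) k * Xf L ν ((-1 : ℤ), (0 : ℤ)) k
      = ((2 * Real.pi / L) ^ 2) ^ 2 * T10n L (ν * (2 * Real.pi / L) ^ 2) := by
  rw [ClosedExp.T10n_eq, Finset.mul_sum]
  rw [← Equiv.sum_comp (Equiv.subRight (K1 L))
    (fun k => ((2 * Real.pi / L) ^ 2) ^ 2 * (gres L (ν * (2 * Real.pi / L) ^ 2) k * gres L (ν * (2 * Real.pi / L) ^ 2) (k + K1 L)))]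
  refine Finset.sum_congr rfl fun k _ => ?_
  rw [Xf_zero_eq, Xf_negx_eq]
  simp only [Equiv.subRight_apply, sub_add_cancel]
  ring

/-! ## The special momenta `0` and `x̂` -/

/-- `G(0) = 0`. [folklore] -/
theorem Xf_zero_at_zero (ν : ℝ) : Xf L ν ((0 : ℤ), (0 : ℤ)) 0 = 0 := by
  rw [Xf_zero_eq]; unfold gres; simp

/-- `G₋(x̂) = 0`. [folklore] -/
theorem Xf_negx_at_K1 (ν : ℝ) : Xf L ν ((-1 : ℤ), (0 : ℤ)) (K1 L) = 0 := by
  rw [Xf_negx_eq]; unfold gres; simp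

/-- `aₓ(0) = 0`. [folklore] -/
theorem ax_zero : ax L 0 = 0 := by
  unfold ax; rw [phase_zero_left]; simp

/-- `aₓ(x̂) = e` and `aₓ(−x̂) = e`. [folklore] -/
theorem ax_K1 : ax L (K1 L) = ee L ∧ ax L (0 - K1 L) = ee L := by
  unfold ax ee
  rw [zero_sub, OuterMaj.phase_K1_ex_re]
  constructor
  · ring
  · rw [phase_neg_left, phase_re_neg, OuterMaj.phase_K1_ex_re]; ring

/-- `s(0) + s(x̂) ≤ 2·Ghi(1,0)²` (both equal `e·G(±x̂)²`, `e ≤ 1`). [folklore] -/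
theorem sN_special_le (K : ℕ) (h4K : 4 * K ≤ L) (hK : 1 ≤ K) (T ν₁ ν₂ ν : ℝ) (hT : (2 * Real.pi / L) ^ 2 ≤ T)
    (h1 : ν₁ ≤ ν) (h2 : ν ≤ ν₂) (hν : ν₂ < 4 / Real.pi ^ 2) (hpos : 0 < winT T ((1 : ℤ), (0 : ℤ)) - ν₂) :
    sN L ν 0 + sN L ν (K1 L) ≤ 2 * GhiR T ν₂ ((1 : ℤ), (0 : ℤ)) ^ 2 := by
  have hνν : ν < 4 / Real.pi ^ 2 := lt_of_le_of_lt h2 hν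
  obtain ⟨he0, he1⟩ := ee_nonneg_le_one L
  have hw1 : ((1 : ℤ), (0 : ℤ)) ∈ zWindow K := by
    rw [mem_zWindow_iff]; refine ⟨by simp, ⟨by omega, by omega⟩, ⟨by omega, by omega⟩⟩
  have hwm1 : ((-1 : ℤ), (0 : ℤ)) ∈ zWindow K := by
    rw [mem_zWindow_iff]; refine ⟨by simp, ⟨by omega, by omega⟩, ⟨by omega, by omega⟩⟩
  have hposm : 0 < winT T ((-1 : ℤ), (0 : ℤ)) - ν₂ := by
    have : winT T ((-1 : ℤ), (0 : ℤ)) = winT T ((1 : ℤ), (0 : ℤ)) := by unfold winT; norm_num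
    rw [this]; exact hpos
  have hsym : GhiR T ν₂ ((-1 : ℤ), (0 : ℤ)) = GhiR T ν₂ ((1 : ℤ), (0 : ℤ)) := by unfold GhiR winT; norm_num
  -- `G(x̂)` and `G(−x̂)` brackets
  obtain ⟨_, hG1, hG10⟩ := Xf_bracket L K h4K T ν₁ ν₂ ν hT h1 h2 hνν ((0 : ℤ), (0 : ℤ)) (K1 L) ((1 : ℤ), (0 : ℤ)) hw1
    (by rw [toTor_zero_zero, add_zero]; unfold toTor K1; simp) hpos
  obtain ⟨_, hGm1, hGm10⟩ := Xf_bracket L K h4K T ν₁ ν₂ ν hT h1 h2 hνν ((-1 : ℤ), (0 : ℤ)) 0 ((-1 : ℤ), (0 : ℤ)) hwm1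
    (by rw [zero_add]) hposm
  have hG0 : 0 ≤ Xf L ν ((0 : ℤ), (0 : ℤ)) (K1 L) := Xf_nonneg L ν hνν _ _
  have hGm0 : 0 ≤ Xf L ν ((-1 : ℤ), (0 : ℤ)) 0 := Xf_nonneg L ν hνν _ _
  -- the two values
  have e0 : sN L ν 0 = ee L * Xf L ν ((-1 : ℤ), (0 : ℤ)) 0 ^ 2 := by
    rw [sN_expand, Xf_zero_at_zero, ax_zero, (ax_K1 L).2]; ring
  have e1 : sN L ν (K1 L) = ee L * Xf L ν ((0 : ℤ), (0 : ℤ)) (K1 L) ^ 2 := by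
    rw [sN_expand, Xf_negx_at_K1, (ax_K1 L).1]; ring
  rw [e0, e1, hsym] at *
  have s0 : ee L * Xf L ν ((-1 : ℤ), (0 : ℤ)) 0 ^ 2 ≤ GhiR T ν₂ ((1 : ℤ), (0 : ℤ)) ^ 2 := by
    have := pow_le_pow_left₀ hGm0 hGm1 2
    nlinarith [sq_nonneg (Xf L ν ((-1 : ℤ), (0 : ℤ)) 0)]
  have s1 : ee L * Xf L ν ((0 : ℤ), (0 : ℤ)) (K1 L) ^ 2 ≤ GhiR T ν₂ ((1 : ℤ), (0 : ℤ)) ^ 2 := by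
    have := pow_le_pow_left₀ hG0 hG1 2
    nlinarith [sq_nonneg (Xf L ν ((0 : ℤ), (0 : ℤ)) (K1 L))]
  linarith

/-! ## The bracket -/

/-- `cTail ν θ ≤ cT T ν₂` and `1 ≤ cTail ν θ` for `θ² ≤ T`, `0 ≤ ν ≤ ν₂`, `T/12 + ν₂ < 1`. [folklore] -/
theorem cTail_le_cT (T ν₂ ν θ : ℝ) (hT : θ ^ 2 ≤ T) (hν0 : 0 ≤ ν) (h2 : ν ≤ ν₂) (hden : 0 < 1 - T / 12 - ν₂) :
    1 ≤ cTail ν θ ∧ cTail ν θ ≤ cT T ν₂ := by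
  unfold cTail cT
  have hden' : 0 < 1 - θ ^ 2 / 12 - ν := by linarith
  have hM : 1 / (1 - θ ^ 2 / 12 - ν) ≤ 1 / (1 - T / 12 - ν₂) := one_div_le_one_div_of_le hden (by linarith)
  have hM0 : 0 ≤ 1 / (1 - θ ^ 2 / 12 - ν) := div_nonneg zero_le_one hden'.le
  have hM0' : 0 ≤ 1 / (1 - T / 12 - ν₂) := div_nonneg zero_le_one hden.le
  constructor
  · have := mul_nonneg hν0 hM0; linarith
  · have := mul_le_mul h2 hM hM0 (le_trans hν0 h2); linarith

/-- ★★ **THE L-UNIFORM BRACKET OF `XSn`.** [folklore] -/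
theorem XSn_le_xsBoundR (K : ℕ) (h4K : 4 * K ≤ L) (hK : 1 ≤ K) (T ν₁ ν₂ ν x4hi x7hi : ℝ)
    (hT : (2 * Real.pi / L) ^ 2 ≤ T) (hT1 : T ≤ 1) (hν₁ : 0 ≤ ν₁) (h1 : ν₁ ≤ ν) (h2 : ν ≤ ν₂) (hν : ν₂ < 4 / Real.pi ^ 2)
    (hden : 0 < 1 - T / 12 - ν₂)
    (hwin : ∀ p ∈ idxX K, 0 < winT T p - ν₂ ∧ 0 < winT T (shx p) - ν₂)
    (hpos1 : 0 < winT T ((1 : ℤ), (0 : ℤ)) - ν₂)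
    (hx4 : ((2 * Real.pi / L) ^ 2) ^ 2 * S2n L (ν * (2 * Real.pi / L) ^ 2) ≤ x4hi)
    (hx7 : ((2 * Real.pi / L) ^ 2) ^ 2 * T10n L (ν * (2 * Real.pi / L) ^ 2) ≤ x7hi) :
    XSn L (ν * (2 * Real.pi / L) ^ 2) ≤ xsBoundR T ν₁ ν₂ K x4hi x7hi := by
  classical
  have hLpos : (0 : ℝ) < L := by exact_mod_cast Nat.pos_of_ne_zero (NeZero.ne L)
  have hL2 : 2 ≤ L := by omega
  have hKL : K < L := by omega
  have h2K : 2 * K < L := by omega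
  have hνν : ν < 4 / Real.pi ^ 2 := lt_of_le_of_lt h2 hν
  have hν0 : 0 ≤ ν := le_trans hν₁ h1
  set θ : ℝ := 2 * Real.pi / L with hθdef
  have hθπ : θ ≤ Real.pi := by
    rw [hθdef, div_le_iff₀ hLpos]
    have : (2 : ℝ) ≤ L := by exact_mod_cast hL2
    nlinarith [Real.pi_pos]
  have hdenθ : 0 < 1 - θ ^ 2 / 12 - ν := by linarith
  obtain ⟨hc1, hcle⟩ := cTail_le_cT T ν₂ ν θ hT hν0 h2 hden
  set c := cTail ν θ with hcdef
  set cU := cT T ν₂ with hcUdef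
  have hc2 : c ^ 2 ≤ cU ^ 2 := pow_le_pow_left₀ (le_trans zero_le_one hc1) hcle 2
  -- notation for the three functions on the torus
  set G : Tor L → ℝ := fun k => Xf L ν ((0 : ℤ), (0 : ℤ)) k with hGdef
  set Gm : Tor L → ℝ := fun k => Xf L ν ((-1 : ℤ), (0 : ℤ)) k with hGmdef
  have hG0 : ∀ k, 0 ≤ G k := fun k => Xf_nonneg L ν hνν _ _
  have hGm0 : ∀ k, 0 ≤ Gm k := fun k => Xf_nonneg L ν hνν _ _
  -- the window image and the decomposition set
  set W : Finset (Tor L) := (idxX K).image (toTor L) with hWdef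
  have hinj : Set.InjOn (toTor L) (idxX K : Set (ℤ × ℤ)) := by
    intro p hp q hq hpq
    have hp' := (Finset.mem_filter.mp (Finset.mem_coe.mp hp)).2.1
    have hq' := (Finset.mem_filter.mp (Finset.mem_coe.mp hq)).2.1
    rw [mem_zWindow_iff] at hp' hq'
    exact intCast_eq_of_mem_box L K h2K p q hp'.2 hq'.2 hpq
  have hW0 : (0 : Tor L) ∉ W := by
    intro h0
    obtain ⟨p, hp, hp0⟩ := Finset.mem_image.mp h0
    exact intCast_ne_zero_of_mem_zWindow L K hKL p (Finset.mem_filter.mp hp).2.1 hp0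
  have hW1 : K1 L ∉ W := by
    intro h1'
    obtain ⟨p, hp, hp1⟩ := Finset.mem_image.mp h1'
    have hm := (Finset.mem_filter.mp hp).2.2
    have h2 : toTor L (shx p) = 0 := by rw [toTor_shx, hp1, sub_self]
    exact intCast_ne_zero_of_mem_zWindow L K hKL (shx p) hm h2
  have h01 : (0 : Tor L) ≠ K1 L := (K1_ne_zero L hL2).symm
  set A : Finset (Tor L) := insert 0 (insert (K1 L) W) with hAdef
  -- sums over A
  have sumA : ∀ f : Tor L → ℝ, ∑ k ∈ A, f k = f 0 + f (K1 L) + ∑ p ∈ idxX K, f (toTor L p) := by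
    intro f
    rw [hAdef, Finset.sum_insert (by
        rw [Finset.mem_insert]; push Not; exact ⟨h01, hW0⟩),
      Finset.sum_insert hW1, hWdef, Finset.sum_image hinj]
    ring
  -- (1) the window part
  have hWin : ∑ p ∈ idxX K, sN L ν (toTor L p) ≤ ∑ p ∈ idxX K, sHiR T ν₁ ν₂ p := by
    apply Finset.sum_le_sum
    intro p hp
    obtain ⟨_, hpw, hpm⟩ := Finset.mem_filter.mp hp
    obtain ⟨hq1, hq2⟩ := hwin p hp
    exact sN_window_le L K h4K T ν₁ ν₂ ν hT hT1 h1 h2 hν p hpw hpm hq1 hq2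
  -- (2) the special momenta
  have hSpec := sN_special_le L K h4K hK T ν₁ ν₂ ν hT h1 h2 hν hpos1
  -- (3) the rest: pointwise tail bound
  have hRest : ∑ k ∈ Aᶜ, sN L ν k ≤ ∑ k ∈ Aᶜ, ((4 * c ^ 2 + 2) * Gm k ^ 2 + 4 * c ^ 2 * (G k * Gm k)) := by
    apply Finset.sum_le_sum
    intro k hk
    have hk1 : k ≠ K1 L := by
      intro h; apply (Finset.mem_compl.mp hk); rw [h, hAdef]; simp
    exact sN_tail_le L ν θ hν0 hνν le_rfl hθπ hdenθ hL2 k hk1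
  -- (4) tail sums = totals − sums over A
  have hsplitGm : ∑ k ∈ Aᶜ, Gm k ^ 2 = ∑ k : Tor L, Gm k ^ 2 - ∑ k ∈ A, Gm k ^ 2 := by
    rw [← Finset.sum_add_sum_compl A (fun k => Gm k ^ 2)]; ring
  have hsplitGG : ∑ k ∈ Aᶜ, G k * Gm k = ∑ k : Tor L, G k * Gm k - ∑ k ∈ A, G k * Gm k := by
    rw [← Finset.sum_add_sum_compl A (fun k => G k * Gm k)]; ring
  have htotGm : ∑ k : Tor L, Gm k ^ 2 ≤ x4hi := by rw [hGmdef]; simp only; rw [sum_Gm_sq]; exact hx4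
  have htotGG : ∑ k : Tor L, G k * Gm k ≤ x7hi := by rw [hGdef, hGmdef]; simp only; rw [sum_G_Gm]; exact hx7
  -- lower bounds of the sums over A
  have hwm1 : ((-1 : ℤ), (0 : ℤ)) ∈ zWindow K := by
    rw [mem_zWindow_iff]; refine ⟨by simp, ⟨by omega, by omega⟩, ⟨by omega, by omega⟩⟩
  have hposm1 : 0 < winT T ((-1 : ℤ), (0 : ℤ)) - ν₂ := by
    have : winT T ((-1 : ℤ), (0 : ℤ)) = winT T ((1 : ℤ), (0 : ℤ)) := by unfold winT; norm_num
    rw [this]; exact hpos1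
  have hAGm : GloR ν₁ ((-1 : ℤ), (0 : ℤ)) ^ 2 + ∑ p ∈ idxX K, GloR ν₁ (shx p) ^ 2 ≤ ∑ k ∈ A, Gm k ^ 2 := by
    rw [sumA]
    have t0 : GloR ν₁ ((-1 : ℤ), (0 : ℤ)) ^ 2 ≤ Gm 0 ^ 2 := by
      obtain ⟨hlo, _, hlo0⟩ := Xf_bracket L K h4K T ν₁ ν₂ ν hT h1 h2 hνν ((-1 : ℤ), (0 : ℤ)) 0 ((-1 : ℤ), (0 : ℤ))
        hwm1 (by rw [zero_add]) hposm1
      exact pow_le_pow_left₀ hlo0 hlo 2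
    have t1 : 0 ≤ Gm (K1 L) ^ 2 := sq_nonneg _
    have t2 : ∑ p ∈ idxX K, GloR ν₁ (shx p) ^ 2 ≤ ∑ p ∈ idxX K, Gm (toTor L p) ^ 2 := by
      apply Finset.sum_le_sum
      intro p hp
      obtain ⟨_, hpw, hpm⟩ := Finset.mem_filter.mp hp
      obtain ⟨_, hq2⟩ := hwin p hp
      obtain ⟨hlo, _, hlo0⟩ := Xf_bracket L K h4K T ν₁ ν₂ ν hT h1 h2 hνν ((-1 : ℤ), (0 : ℤ)) (toTor L p) (shx p) hpm
        (by unfold shx; rw [← toTor_add]) hq2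
      exact pow_le_pow_left₀ hlo0 hlo 2
    linarith
  have hAGG : ∑ p ∈ idxX K, GloR ν₁ p * GloR ν₁ (shx p) ≤ ∑ k ∈ A, G k * Gm k := by
    rw [sumA]
    have t0 : 0 ≤ G 0 * Gm 0 := mul_nonneg (hG0 _) (hGm0 _)
    have t1 : 0 ≤ G (K1 L) * Gm (K1 L) := mul_nonneg (hG0 _) (hGm0 _)
    have t2 : ∑ p ∈ idxX K, GloR ν₁ p * GloR ν₁ (shx p) ≤ ∑ p ∈ idxX K, G (toTor L p) * Gm (toTor L p) := by
      apply Finset.sum_le_sum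
      intro p hp
      obtain ⟨_, hpw, hpm⟩ := Finset.mem_filter.mp hp
      obtain ⟨hq1, hq2⟩ := hwin p hp
      obtain ⟨hlo, _, hlo0⟩ := Xf_bracket L K h4K T ν₁ ν₂ ν hT h1 h2 hνν ((0 : ℤ), (0 : ℤ)) (toTor L p) p hpw
        (by rw [toTor_zero_zero, add_zero]) hq1
      obtain ⟨hlom, _, hlom0⟩ := Xf_bracket L K h4K T ν₁ ν₂ ν hT h1 h2 hνν ((-1 : ℤ), (0 : ℤ)) (toTor L p) (shx p) hpm
        (by unfold shx; rw [← toTor_add]) hq2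
      exact mul_le_mul hlo hlom hlom0 (le_trans hlo0 hlo)
    linarith
  -- nonnegativity of the tail sums
  have hRGm0 : 0 ≤ ∑ k ∈ Aᶜ, Gm k ^ 2 := Finset.sum_nonneg fun k _ => sq_nonneg _
  have hRGG0 : 0 ≤ ∑ k ∈ Aᶜ, G k * Gm k := Finset.sum_nonneg fun k _ => mul_nonneg (hG0 _) (hGm0 _)
  -- assemble
  rw [XSn_eq_sum_sN, ← Finset.sum_add_sum_compl A (sN L ν), sumA]
  unfold xsBoundR
  rw [← hcUdef]
  have hR' : ∑ k ∈ Aᶜ, ((4 * c ^ 2 + 2) * Gm k ^ 2 + 4 * c ^ 2 * (G k * Gm k))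
      = (4 * c ^ 2 + 2) * ∑ k ∈ Aᶜ, Gm k ^ 2 + 4 * c ^ 2 * ∑ k ∈ Aᶜ, G k * Gm k := by
    rw [Finset.sum_add_distrib, Finset.mul_sum, Finset.mul_sum]
  have hR2 : (4 * c ^ 2 + 2) * ∑ k ∈ Aᶜ, Gm k ^ 2 + 4 * c ^ 2 * ∑ k ∈ Aᶜ, G k * Gm k
      ≤ (4 * cU ^ 2 + 2) * ∑ k ∈ Aᶜ, Gm k ^ 2 + 4 * cU ^ 2 * ∑ k ∈ Aᶜ, G k * Gm k := by
    have a1 := mul_le_mul_of_nonneg_right hc2 hRGm0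
    have a2 := mul_le_mul_of_nonneg_right hc2 hRGG0
    linarith
  have hR3 : (4 * cU ^ 2 + 2) * ∑ k ∈ Aᶜ, Gm k ^ 2
      ≤ (4 * cU ^ 2 + 2) * (x4hi - GloR ν₁ ((-1 : ℤ), (0 : ℤ)) ^ 2 - ∑ p ∈ idxX K, GloR ν₁ (shx p) ^ 2) := by
    apply mul_le_mul_of_nonneg_left _ (by positivity)
    rw [hsplitGm]; linarith
  have hR4 : 4 * cU ^ 2 * ∑ k ∈ Aᶜ, G k * Gm k ≤ 4 * cU ^ 2 * (x7hi - ∑ p ∈ idxX K, GloR ν₁ p * GloR ν₁ (shx p)) := by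
    apply mul_le_mul_of_nonneg_left _ (by positivity)
    rw [hsplitGG]; linarith
  have hGm_def : ∀ k, Gm k = Xf L ν ((-1 : ℤ), (0 : ℤ)) k := fun k => rfl
  have hG_def : ∀ k, G k = Xf L ν ((0 : ℤ), (0 : ℤ)) k := fun k => rfl
  linarith [hWin, hSpec, hRest, hR', hR2, hR3, hR4]

end RowC

end Summit.HubbardSuperconductivity.HubbardSuperconductivity.Theorems.AnisotropyChord.Transfer.Fibre3

end
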